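import Mathlib.MeasureTheory.Integral.MeanInequalities
import Mathlib.MeasureTheory.Integral.Lebesgue.Map
import Mathlib.Analysis.SpecialFunctions.Pow.NNReal
import Literature.Analysis.FluidPDE.HardSphereDynamics
import Mathlib.MeasureTheory.Integral.IntervalIntegral.Basic
import Mathlib.MeasureTheory.Integral.Prod
import HarnessLib

/-!
# Window exponential-moment subadditivity under a flow-invariant law (helper, layer 2)

Crux `Summit.AtomisticToContinuum.HydrodynamicLimit.Theses.AntiMazurCoboundaries.KineticWindowGronwall`
(stmt-AtomisticToContinuum-9282), line `dlr-block-transfer` v4, helper toward the lead's stub `stub_blockTransfer`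
(step "common window by `Λ_{mτ} ≤ Λ_τ` under the INVARIANT homogeneous law"; also the "`τ Λ_τ` subadditive by
Hölder + invariance" step of the shared crux stmt-10967 `KineticFluxLdDecay`). Layer 1 is
`…KineticWindowGronwallCesaroExpMoment` (`lintegral_exp_cesaro_le`: Cesàro exponential moments along a
measure-preserving map); this file is self-contained (a private copy `cesaro_aux` of that Hölder step, extended here
to `P`-a.e. measurable functionals, `lintegral_exp_cesaro_le_of_aemeasurable`).

For a hard-sphere flow `Φ` (`HardSphereFlow`: good set `good`, group law `flow_add` on `good`), a law `P` on phase space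
carried by `good` (`P goodᶜ = 0`) and invariant under `Φ.flow` (the homogeneous local Gibbs law is such:
`Theorems.map_flow_localGibbsLaw_const`), an observable `F` with `s ↦ F (Φ_s z)` interval-integrable along good orbits,
windows `h, h₁, h₂` and `m ≥ 1`:
* `Λ_{mh} ≤ Λ_h`: `∫⁻ exp ((mh)⁻¹ ∫₀^{mh} F (Φ_s z) ds) dP ≤ ∫⁻ exp (h⁻¹ ∫₀ʰ F (Φ_s z) ds) dP`
  (`lintegral_exp_window_mul_le_of_aemeasurable`, weighted `lintegral_exp_smul_window_mul_le_of_aemeasurable`,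
  registered helper stub `stub_windowExpMomentSubadditivity : WindowExpMomentSubadditivity`);
* `(h₁+h₂) Λ_{h₁+h₂} ≤ h₁ Λ_{h₁} + h₂ Λ_{h₂}` at every exponent weight `β`:
  `∫⁻ exp (β (h₁+h₂)⁻¹ ∫₀^{h₁+h₂} …) dP ≤
    (∫⁻ exp (β h₁⁻¹ ∫₀^{h₁} …) dP)^{h₁/(h₁+h₂)} (∫⁻ exp (β h₂⁻¹ ∫₀^{h₂} …) dP)^{h₂/(h₁+h₂)}`
  (`lintegral_exp_window_add_le_of_aemeasurable`, registered helper stub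
  `stub_twoWindowExpMomentSubadditivity : TwoWindowExpMomentSubadditivity`).
MEASURABILITY. The registered statements assume that `(s, z) ↦ F (Φ_s z)` is jointly measurable; since the
values of a `HardSphereFlow` off `good` are unspecified, the forms to use for an ARBITRARY flow are the
`_of_aemeasurable` theorems, which only ask the one-window functional `z ↦ ∫₀ʰ F (Φ_s z) ds` to be `P`-a.e.
measurable — implied by joint measurability of any modification `g` of `(s, z) ↦ F (Φ_s z)` along good orbits
(`aemeasurable_window_of_modification`, Fubini measurability `measurable_intervalIntegral_right`).
PROOF. On `good`, `∫₀^{mh} = Σ_{k<m} ∫_{kh}^{(k+1)h}` (`intervalIntegral.sum_integral_adjacent_intervals`) and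
`∫_{kh}^{(k+1)h} F (Φ_s z) ds = ∫₀ʰ F (Φ_s (Φ_{kh} z)) ds` (`flow_add`, `intervalIntegral.integral_comp_add_right`),
while `(Φ_h)^[k] = Φ_{kh}` on `good`; so the exponent is the Cesàro average `m⁻¹ Σ_{k<m} Y ((Φ_h)^[k] z)` of
`Y z = h⁻¹ ∫₀ʰ F (Φ_s z) ds` `P`-a.e., and layer 1 applies to the measure-preserving map `Φ_h`. The two-window bound is
the two-function Hölder inequality `ENNReal.lintegral_mul_norm_pow_le` with exponents `h₁/(h₁+h₂) + h₂/(h₁+h₂) = 1` and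
invariance under `Φ_{h₁}`.
-/

noncomputable section

open scoped BigOperators ENNReal
open MeasureTheory Finset Function Set
open Literature.Analysis.FluidPDE

namespace Summit.AtomisticToContinuum.HydrodynamicLimit.Theorems.KineticWindowGronwallWindowSubadditivity

/-- **WINDOW EXPONENTIAL-MOMENT SUBADDITIVITY `Λ_{mh} ≤ Λ_h`** (Hölder + invariance, flow version). For a hard-sphere
flow `Φ`, a measure `P` on phase space with `P Φ.goodᶜ = 0` and `Φ.flow t` measure-preserving for every `t`, an
observable `F` such that `(s, z) ↦ F (Φ.flow s z)` is jointly measurable and `s ↦ F (Φ.flow s z)` is interval-integrable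
on every time interval for every good `z` (local integrability in time), every `h > 0` and `0 < m`:
`∫⁻ exp ((m h)⁻¹ ∫₀^{m h} F (Φ_s z) ds) dP ≤ ∫⁻ exp (h⁻¹ ∫₀ʰ F (Φ_s z) ds) dP`.
Folklore (subadditivity of `τ ↦ τ Λ_τ` for window log-moment generating functions under a stationary dynamics). -/
def WindowExpMomentSubadditivity : Prop :=
  ∀ {d : Type*} [Fintype d] {X : Type*} [MeasureSpace X] [TopologicalSpace X] {G : Geometry d X} {ε : ℝ} {N : ℕ}
    (Φ : HardSphereFlow G ε N) (P : Measure (Config N d X)),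
    P Φ.goodᶜ = 0 → (∀ t : ℝ, MeasurePreserving (Φ.flow t) P P) →
    ∀ (F : Config N d X → ℝ), Measurable (fun p : ℝ × Config N d X => F (Φ.flow p.1 p.2)) →
    (∀ z ∈ Φ.good, ∀ a b : ℝ, IntervalIntegrable (fun s => F (Φ.flow s z)) volume a b) →
    ∀ (h : ℝ), 0 < h → ∀ (m : ℕ), 0 < m →
    ∫⁻ z, ENNReal.ofReal (Real.exp (((m : ℝ) * h)⁻¹ * ∫ s in (0 : ℝ)..((m : ℝ) * h), F (Φ.flow s z))) ∂P ≤
      ∫⁻ z, ENNReal.ofReal (Real.exp (h⁻¹ * ∫ s in (0 : ℝ)..h, F (Φ.flow s z))) ∂P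

/-- **TWO-WINDOW SUBADDITIVITY `(h₁ + h₂) Λ_{h₁+h₂} ≤ h₁ Λ_{h₁} + h₂ Λ_{h₂}`** (Hölder with exponents
`(h₁+h₂)/h₁`, `(h₁+h₂)/h₂` + invariance). Same frame as `WindowExpMomentSubadditivity`; for every exponent weight `β`
and windows `h₁, h₂ > 0`:
`∫⁻ exp (β (h₁+h₂)⁻¹ ∫₀^{h₁+h₂} F (Φ_s z) ds) dP ≤ (∫⁻ exp (β h₁⁻¹ ∫₀^{h₁} F (Φ_s z) ds) dP)^{h₁/(h₁+h₂)} ·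
(∫⁻ exp (β h₂⁻¹ ∫₀^{h₂} F (Φ_s z) ds) dP)^{h₂/(h₁+h₂)}` — subadditivity of `τ ↦ τ Λ_τ(β)` for the window log-moment
generating function `Λ_τ(β) = log ∫⁻ exp (β τ⁻¹ ∫₀^τ F ∘ Φ_s ds) dP` under a stationary law. Folklore. -/
def TwoWindowExpMomentSubadditivity : Prop :=
  ∀ {d : Type*} [Fintype d] {X : Type*} [MeasureSpace X] [TopologicalSpace X] {G : Geometry d X} {ε : ℝ} {N : ℕ}
    (Φ : HardSphereFlow G ε N) (P : Measure (Config N d X)),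
    P Φ.goodᶜ = 0 → (∀ t : ℝ, MeasurePreserving (Φ.flow t) P P) →
    ∀ (F : Config N d X → ℝ), Measurable (fun p : ℝ × Config N d X => F (Φ.flow p.1 p.2)) →
    (∀ z ∈ Φ.good, ∀ a b : ℝ, IntervalIntegrable (fun s => F (Φ.flow s z)) volume a b) →
    ∀ (β h₁ h₂ : ℝ), 0 < h₁ → 0 < h₂ →
    ∫⁻ z, ENNReal.ofReal (Real.exp (β * ((h₁ + h₂)⁻¹ * ∫ s in (0 : ℝ)..(h₁ + h₂), F (Φ.flow s z)))) ∂P ≤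
      (∫⁻ z, ENNReal.ofReal (Real.exp (β * (h₁⁻¹ * ∫ s in (0 : ℝ)..h₁, F (Φ.flow s z)))) ∂P) ^ (h₁ / (h₁ + h₂)) *
      (∫⁻ z, ENNReal.ofReal (Real.exp (β * (h₂⁻¹ * ∫ s in (0 : ℝ)..h₂, F (Φ.flow s z)))) ∂P) ^ (h₂ / (h₁ + h₂))

/-! ### Layer 1 for a.e.-measurable functionals; Fubini measurability of window functionals -/

-- adapted from `lintegral_exp_cesaro_le` (Theorems/AntiMazurCoboundariesKineticWindowGronwallCesaroExpMoment.lean)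
/-- Layer 1 (private copy): `∫⁻ exp (m⁻¹ Σ_{k<m} Y ∘ T^[k]) dP ≤ ∫⁻ exp Y dP` for `T` preserving `P`, `Y` measurable,
`0 < m` — finite Hölder `ENNReal.lintegral_prod_norm_pow_le` with equal exponents `1/m` and invariance. [folklore] -/
private theorem cesaro_aux {α : Type*} [MeasurableSpace α] (P : Measure α) (T : α → α)
    (hT : MeasurePreserving T P P) (Y : α → ℝ) (hY : Measurable Y) (m : ℕ) (hm : 0 < m) :
    ∫⁻ z, ENNReal.ofReal (Real.exp ((m : ℝ)⁻¹ * ∑ k ∈ Finset.range m, Y (T^[k] z))) ∂P ≤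
      ∫⁻ z, ENNReal.ofReal (Real.exp (Y z)) ∂P := by
  have hm0 : (m : ℝ) ≠ 0 := Nat.cast_ne_zero.mpr hm.ne'
  have hc : 0 ≤ (m : ℝ)⁻¹ := inv_nonneg.mpr (Nat.cast_nonneg m)
  have hmeas : ∀ k ∈ Finset.range m,
      AEMeasurable (fun z => ENNReal.ofReal (Real.exp (Y (T^[k] z)))) P := fun k _ =>
    ((hY.comp (hT.measurable.iterate k)).exp.ennreal_ofReal).aemeasurable
  have hsum : ∑ _k ∈ Finset.range m, (m : ℝ)⁻¹ = 1 := by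
    rw [Finset.sum_const, Finset.card_range, nsmul_eq_mul, mul_inv_cancel₀ hm0]
  have hpt : ∀ z, ENNReal.ofReal (Real.exp ((m : ℝ)⁻¹ * ∑ k ∈ Finset.range m, Y (T^[k] z))) =
      ∏ k ∈ Finset.range m, ENNReal.ofReal (Real.exp (Y (T^[k] z))) ^ (m : ℝ)⁻¹ := fun z => by
    rw [Finset.mul_sum, Real.exp_sum, ENNReal.ofReal_prod_of_nonneg fun i _ => (Real.exp_pos _).le]
    refine Finset.prod_congr rfl fun k _ => ?_
    rw [mul_comm, Real.exp_mul, ENNReal.ofReal_rpow_of_nonneg (Real.exp_pos _).le hc]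
  have hinv : ∀ k : ℕ, ∫⁻ z, ENNReal.ofReal (Real.exp (Y (T^[k] z))) ∂P =
      ∫⁻ z, ENNReal.ofReal (Real.exp (Y z)) ∂P := fun k =>
    (hT.iterate k).lintegral_comp (f := fun z => ENNReal.ofReal (Real.exp (Y z))) hY.exp.ennreal_ofReal
  calc ∫⁻ z, ENNReal.ofReal (Real.exp ((m : ℝ)⁻¹ * ∑ k ∈ Finset.range m, Y (T^[k] z))) ∂P
      = ∫⁻ z, ∏ k ∈ Finset.range m, ENNReal.ofReal (Real.exp (Y (T^[k] z))) ^ (m : ℝ)⁻¹ ∂P :=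
        lintegral_congr hpt
    _ ≤ ∏ k ∈ Finset.range m, (∫⁻ z, ENNReal.ofReal (Real.exp (Y (T^[k] z))) ∂P) ^ (m : ℝ)⁻¹ :=
        ENNReal.lintegral_prod_norm_pow_le (Finset.range m) hmeas hsum fun _ _ => hc
    _ = ∏ _k ∈ Finset.range m, (∫⁻ z, ENNReal.ofReal (Real.exp (Y z)) ∂P) ^ (m : ℝ)⁻¹ :=
        Finset.prod_congr rfl fun k _ => by rw [hinv k]
    _ = ∫⁻ z, ENNReal.ofReal (Real.exp (Y z)) ∂P := by
        rw [Finset.prod_const, Finset.card_range, ENNReal.rpow_inv_natCast_pow hm.ne']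

/-- Layer 1 with `Y` only `P`-a.e. measurable: replace `Y` by a measurable modification,
a.e. along every iterate since `T^[k]` preserves `P` (`QuasiMeasurePreserving.ae_eq`). [folklore] -/
theorem lintegral_exp_cesaro_le_of_aemeasurable {α : Type*} [MeasurableSpace α] (P : Measure α) (T : α → α)
    (hT : MeasurePreserving T P P) (Y : α → ℝ) (hY : AEMeasurable Y P) (m : ℕ) (hm : 0 < m) :
    ∫⁻ z, ENNReal.ofReal (Real.exp ((m : ℝ)⁻¹ * ∑ k ∈ Finset.range m, Y (T^[k] z))) ∂P ≤
      ∫⁻ z, ENNReal.ofReal (Real.exp (Y z)) ∂P := by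
  have hk : ∀ k : ℕ, Y ∘ T^[k] =ᵐ[P] hY.mk Y ∘ T^[k] := fun k =>
    (hT.iterate k).quasiMeasurePreserving.ae_eq hY.ae_eq_mk
  have hall : ∀ᵐ z ∂P, ∀ k : ℕ, Y (T^[k] z) = hY.mk Y (T^[k] z) := ae_all_iff.mpr hk
  calc ∫⁻ z, ENNReal.ofReal (Real.exp ((m : ℝ)⁻¹ * ∑ k ∈ Finset.range m, Y (T^[k] z))) ∂P
      = ∫⁻ z, ENNReal.ofReal (Real.exp ((m : ℝ)⁻¹ * ∑ k ∈ Finset.range m, hY.mk Y (T^[k] z))) ∂P := by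
        refine lintegral_congr_ae ?_
        filter_upwards [hall] with z hz
        rw [Finset.sum_congr rfl fun k _ => hz k]
    _ ≤ ∫⁻ z, ENNReal.ofReal (Real.exp (hY.mk Y z)) ∂P :=
        cesaro_aux P T hT (hY.mk Y) hY.measurable_mk m hm
    _ = ∫⁻ z, ENNReal.ofReal (Real.exp (Y z)) ∂P := by
        refine lintegral_congr_ae ?_
        filter_upwards [hY.ae_eq_mk] with z hz
        rw [← hz]

/-- Fubini measurability of a window functional: if `(s, z) ↦ f s z` is jointly measurable then
`z ↦ ∫ s in a..b, f s z` is measurable. [folklore] -/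
theorem measurable_intervalIntegral_right {α : Type*} [MeasurableSpace α] {f : ℝ → α → ℝ}
    (hf : Measurable fun p : ℝ × α => f p.1 p.2) (a b : ℝ) :
    Measurable fun z => ∫ s in a..b, f s z := by
  have hsm : StronglyMeasurable (Function.uncurry f) := hf.stronglyMeasurable
  simp only [intervalIntegral]
  exact (hsm.integral_prod_left (μ := volume.restrict (Set.Ioc a b))).measurable.sub
    (hsm.integral_prod_left (μ := volume.restrict (Set.Ioc b a))).measurable

/-- Pointwise identity in `ℝ≥0∞`: for `0 ≤ c`, `exp (c a) = (exp a)^c`. [folklore] -/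
theorem ofReal_exp_mul_left (c a : ℝ) (hc : 0 ≤ c) :
    ENNReal.ofReal (Real.exp (c * a)) = ENNReal.ofReal (Real.exp a) ^ c := by
  rw [mul_comm, Real.exp_mul, ENNReal.ofReal_rpow_of_nonneg (Real.exp_pos _).le hc]

/-- Invariance of the exponential moment of a `P`-a.e. measurable functional along a measure-preserving map:
`∫⁻ exp (Y ∘ T) dP = ∫⁻ exp Y dP`. [folklore] -/
theorem lintegral_ofReal_exp_comp_of_aemeasurable {α : Type*} [MeasurableSpace α] {P : Measure α} {T : α → α}
    (hT : MeasurePreserving T P P) {Y : α → ℝ} (hY : AEMeasurable Y P) :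
    ∫⁻ z, ENNReal.ofReal (Real.exp (Y (T z))) ∂P = ∫⁻ z, ENNReal.ofReal (Real.exp (Y z)) ∂P := by
  have hg : AEMeasurable (fun z => ENNReal.ofReal (Real.exp (Y z))) (Measure.map T P) := by
    rw [hT.map_eq]
    exact ENNReal.measurable_ofReal.comp_aemeasurable (Real.measurable_exp.comp_aemeasurable hY)
  rw [← lintegral_map' hg hT.measurable.aemeasurable, hT.map_eq]

/-! ### The flow on its good set -/

section Flow

variable {d : Type*} [Fintype d] {X : Type*} [MeasureSpace X] [TopologicalSpace X] {G : Geometry d X} {ε : ℝ}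
  {N : ℕ} (Φ : HardSphereFlow G ε N)

/-- Iterates of the time-`h` map are the flow at multiples of `h` on the good set: `(Φ_h)^[k] z = Φ_{k h} z`.
[folklore] -/
theorem iterate_flow_apply {z : Config N d X} (hz : z ∈ Φ.good) (h : ℝ) (k : ℕ) :
    (Φ.flow h)^[k] z = Φ.flow ((k : ℝ) * h) z := by
  induction k with
  | zero => simp [Φ.flow_zero z hz]
  | succ k ih =>
      rw [Function.iterate_succ_apply', ih, ← Φ.flow_add h ((k : ℝ) * h) z hz]
      congr 1
      push_cast
      ring

/-- Shifting a time window along a good orbit: `∫₀ʰ F (Φ_s (Φ_c z)) ds = ∫_c^{c+h} F (Φ_s z) ds`. [folklore] -/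
theorem intervalIntegral_flow_shift (F : Config N d X → ℝ) {z : Config N d X} (hz : z ∈ Φ.good) (c h : ℝ) :
    ∫ s in (0 : ℝ)..h, F (Φ.flow s (Φ.flow c z)) = ∫ s in c..(c + h), F (Φ.flow s z) := by
  have hpt : (fun s => F (Φ.flow s (Φ.flow c z))) = fun s => F (Φ.flow (s + c) z) := by
    funext s
    rw [Φ.flow_add s c z hz]
  rw [hpt, intervalIntegral.integral_comp_add_right (fun s => F (Φ.flow s z)) c, zero_add, add_comm]

/-- The long window is the Cesàro average of the one-window functional along the iterates of `Φ_h`, on the good set: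
`(m h)⁻¹ ∫₀^{m h} F (Φ_s z) ds = m⁻¹ Σ_{k<m} h⁻¹ ∫₀ʰ F (Φ_s ((Φ_h)^[k] z)) ds`. [folklore] -/
theorem window_eq_cesaro (F : Config N d X → ℝ) {z : Config N d X} (hz : z ∈ Φ.good)
    (hint : ∀ a b : ℝ, IntervalIntegrable (fun s => F (Φ.flow s z)) volume a b) (h : ℝ) (m : ℕ) :
    ((m : ℝ) * h)⁻¹ * ∫ s in (0 : ℝ)..((m : ℝ) * h), F (Φ.flow s z) =
      (m : ℝ)⁻¹ * ∑ k ∈ Finset.range m, h⁻¹ * ∫ s in (0 : ℝ)..h, F (Φ.flow s ((Φ.flow h)^[k] z)) := by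
  have hsum := intervalIntegral.sum_integral_adjacent_intervals (a := fun k : ℕ => (k : ℝ) * h) (n := m)
    (f := fun s => F (Φ.flow s z)) (μ := volume) fun k _ => hint _ _
  simp only [Nat.cast_zero, zero_mul] at hsum
  rw [← hsum, ← Finset.mul_sum, mul_inv, mul_assoc]
  congr 2
  refine Finset.sum_congr rfl fun k _ => ?_
  rw [iterate_flow_apply Φ hz h k, intervalIntegral_flow_shift Φ F hz]
  congr 1
  push_cast
  ring

/-- Splitting a window in two along a good orbit:
`∫₀^{h₁+h₂} F (Φ_s z) ds = ∫₀^{h₁} F (Φ_s z) ds + ∫₀^{h₂} F (Φ_s (Φ_{h₁} z)) ds`. [folklore] -/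
theorem window_add_eq (F : Config N d X → ℝ) {z : Config N d X} (hz : z ∈ Φ.good)
    (hint : ∀ a b : ℝ, IntervalIntegrable (fun s => F (Φ.flow s z)) volume a b) (h₁ h₂ : ℝ) :
    ∫ s in (0 : ℝ)..(h₁ + h₂), F (Φ.flow s z) =
      (∫ s in (0 : ℝ)..h₁, F (Φ.flow s z)) + ∫ s in (0 : ℝ)..h₂, F (Φ.flow s (Φ.flow h₁ z)) := by
  rw [intervalIntegral_flow_shift Φ F hz h₁ h₂,
    intervalIntegral.integral_add_adjacent_intervals (hint 0 h₁) (hint h₁ (h₁ + h₂))]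

/-! ### The theorem -/

variable (P : Measure (Config N d X))

/-- **Measurability bridge.** If some jointly measurable `g : ℝ → Config → ℝ` agrees with `(s, z) ↦ F (Φ_s z)` along
every good orbit, then every window functional `z ↦ ∫ₐᵇ F (Φ_s z) ds` is `P`-a.e. measurable (`P Φ.goodᶜ = 0`).
[folklore] -/
theorem aemeasurable_window_of_modification (hP : P Φ.goodᶜ = 0) (F : Config N d X → ℝ)
    {g : ℝ → Config N d X → ℝ} (hg : Measurable fun p : ℝ × Config N d X => g p.1 p.2)
    (hgF : ∀ z ∈ Φ.good, ∀ s, g s z = F (Φ.flow s z)) (a b : ℝ) :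
    AEMeasurable (fun z => ∫ s in a..b, F (Φ.flow s z)) P := by
  refine ⟨fun z => ∫ s in a..b, g s z, measurable_intervalIntegral_right hg a b, ?_⟩
  filter_upwards [(mem_ae_iff.mpr hP : ∀ᵐ z ∂P, z ∈ Φ.good)] with z hz
  exact intervalIntegral.integral_congr fun s _ => (hgF z hz s).symm

/-- **Layer 2, robust applied form.** For a measure `P` carried by `Φ.good` and preserved by the time-`h` map `Φ_h`,
an observable `F` interval-integrable in time along good orbits whose ONE-window functional
`z ↦ ∫₀ʰ F (Φ_s z) ds` is `P`-a.e. measurable, and `0 < m`: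
`∫⁻ exp ((m h)⁻¹ ∫₀^{m h} F (Φ_s z) ds) dP ≤ ∫⁻ exp (h⁻¹ ∫₀ʰ F (Φ_s z) ds) dP` (no sign condition on `h`; this is
the form to use for an arbitrary flow, whose values off `good` are unspecified). [folklore] -/
theorem lintegral_exp_window_mul_le_of_aemeasurable (hP : P Φ.goodᶜ = 0) (h : ℝ)
    (hinv : MeasurePreserving (Φ.flow h) P P) (F : Config N d X → ℝ)
    (hint : ∀ z ∈ Φ.good, ∀ a b : ℝ, IntervalIntegrable (fun s => F (Φ.flow s z)) volume a b)
    (hY : AEMeasurable (fun z => ∫ s in (0 : ℝ)..h, F (Φ.flow s z)) P) (m : ℕ) (hm : 0 < m) :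
    ∫⁻ z, ENNReal.ofReal (Real.exp (((m : ℝ) * h)⁻¹ * ∫ s in (0 : ℝ)..((m : ℝ) * h), F (Φ.flow s z))) ∂P ≤
      ∫⁻ z, ENNReal.ofReal (Real.exp (h⁻¹ * ∫ s in (0 : ℝ)..h, F (Φ.flow s z))) ∂P := by
  set Y : Config N d X → ℝ := fun z => h⁻¹ * ∫ s in (0 : ℝ)..h, F (Φ.flow s z) with hYdef
  have hYm : AEMeasurable Y P := hY.const_mul _
  have hae : ∀ᵐ z ∂P, z ∈ Φ.good := mem_ae_iff.mpr hP
  calc ∫⁻ z, ENNReal.ofReal (Real.exp (((m : ℝ) * h)⁻¹ * ∫ s in (0 : ℝ)..((m : ℝ) * h), F (Φ.flow s z))) ∂P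
      = ∫⁻ z, ENNReal.ofReal (Real.exp ((m : ℝ)⁻¹ * ∑ k ∈ Finset.range m, Y ((Φ.flow h)^[k] z))) ∂P := by
        refine lintegral_congr_ae (hae.mono fun z hz => ?_)
        simp only [hYdef]
        rw [window_eq_cesaro Φ F hz (hint z hz) h m]
    _ ≤ ∫⁻ z, ENNReal.ofReal (Real.exp (Y z)) ∂P :=
        lintegral_exp_cesaro_le_of_aemeasurable P (Φ.flow h) hinv Y hYm m hm

/-- **Layer 2, robust weighted form**: under the hypotheses of `lintegral_exp_window_mul_le_of_aemeasurable`, for every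
real exponent weight `β`: `∫⁻ exp (β (m h)⁻¹ ∫₀^{m h} F (Φ_s z) ds) dP ≤ ∫⁻ exp (β h⁻¹ ∫₀ʰ F (Φ_s z) ds) dP`
(the unweighted form for `β • F`). [folklore] -/
theorem lintegral_exp_smul_window_mul_le_of_aemeasurable (hP : P Φ.goodᶜ = 0) (h : ℝ)
    (hinv : MeasurePreserving (Φ.flow h) P P) (F : Config N d X → ℝ)
    (hint : ∀ z ∈ Φ.good, ∀ a b : ℝ, IntervalIntegrable (fun s => F (Φ.flow s z)) volume a b)
    (hY : AEMeasurable (fun z => ∫ s in (0 : ℝ)..h, F (Φ.flow s z)) P) (m : ℕ) (hm : 0 < m) (β : ℝ) :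
    ∫⁻ z, ENNReal.ofReal (Real.exp (β * (((m : ℝ) * h)⁻¹ * ∫ s in (0 : ℝ)..((m : ℝ) * h), F (Φ.flow s z)))) ∂P ≤
      ∫⁻ z, ENNReal.ofReal (Real.exp (β * (h⁻¹ * ∫ s in (0 : ℝ)..h, F (Φ.flow s z)))) ∂P := by
  have hint' : ∀ z ∈ Φ.good, ∀ a b : ℝ, IntervalIntegrable (fun s => β * F (Φ.flow s z)) volume a b :=
    fun z hz a b => (hint z hz a b).const_mul β
  have hY' : AEMeasurable (fun z => ∫ s in (0 : ℝ)..h, β * F (Φ.flow s z)) P := by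
    simp_rw [intervalIntegral.integral_const_mul]
    exact hY.const_mul β
  have key := lintegral_exp_window_mul_le_of_aemeasurable Φ P hP h hinv (fun z => β * F z) hint' hY' m hm
  have e : ∀ x I : ℝ, x⁻¹ * (β * I) = β * (x⁻¹ * I) := fun x I => by ring
  simp only [intervalIntegral.integral_const_mul, e] at key
  exact key

/-- **Layer 2 with joint measurability** (the hypotheses of `WindowExpMomentSubadditivity`, weighted, any real `h`):
if `(s, z) ↦ F (Φ_s z)` is jointly measurable, the one-window functional is `P`-a.e. measurable
(`aemeasurable_window_of_modification` with `g = F ∘ Φ`) and the robust form applies. [folklore] -/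
theorem lintegral_exp_smul_window_mul_le (hP : P Φ.goodᶜ = 0) (hinv : ∀ t : ℝ, MeasurePreserving (Φ.flow t) P P)
    (F : Config N d X → ℝ) (hF : Measurable fun p : ℝ × Config N d X => F (Φ.flow p.1 p.2))
    (hint : ∀ z ∈ Φ.good, ∀ a b : ℝ, IntervalIntegrable (fun s => F (Φ.flow s z)) volume a b)
    (h : ℝ) (m : ℕ) (hm : 0 < m) (β : ℝ) :
    ∫⁻ z, ENNReal.ofReal (Real.exp (β * (((m : ℝ) * h)⁻¹ * ∫ s in (0 : ℝ)..((m : ℝ) * h), F (Φ.flow s z)))) ∂P ≤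
      ∫⁻ z, ENNReal.ofReal (Real.exp (β * (h⁻¹ * ∫ s in (0 : ℝ)..h, F (Φ.flow s z)))) ∂P :=
  lintegral_exp_smul_window_mul_le_of_aemeasurable Φ P hP h (hinv h) F hint
    (aemeasurable_window_of_modification Φ P hP F hF (fun _ _ _ => rfl) 0 h) m hm β

/-- **Two-window subadditivity, robust applied form.** For `P` carried by `Φ.good` and preserved by `Φ_{h₁}`, an
observable `F` interval-integrable in time along good orbits whose one-window functionals at windows `h₁, h₂ > 0` are
`P`-a.e. measurable, and every `β`:
`∫⁻ exp (β (h₁+h₂)⁻¹ ∫₀^{h₁+h₂} F (Φ_s z) ds) dP ≤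
  (∫⁻ exp (β h₁⁻¹ ∫₀^{h₁} …) dP)^{h₁/(h₁+h₂)} (∫⁻ exp (β h₂⁻¹ ∫₀^{h₂} …) dP)^{h₂/(h₁+h₂)}` — Hölder
`ENNReal.lintegral_mul_norm_pow_le` and invariance (`lintegral_ofReal_exp_comp_of_aemeasurable`). [folklore] -/
theorem lintegral_exp_window_add_le_of_aemeasurable (hP : P Φ.goodᶜ = 0) {h₁ h₂ : ℝ} (h₁0 : 0 < h₁) (h₂0 : 0 < h₂)
    (hinv : MeasurePreserving (Φ.flow h₁) P P) (F : Config N d X → ℝ)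
    (hint : ∀ z ∈ Φ.good, ∀ a b : ℝ, IntervalIntegrable (fun s => F (Φ.flow s z)) volume a b)
    (hY₁ : AEMeasurable (fun z => ∫ s in (0 : ℝ)..h₁, F (Φ.flow s z)) P)
    (hY₂ : AEMeasurable (fun z => ∫ s in (0 : ℝ)..h₂, F (Φ.flow s z)) P) (β : ℝ) :
    ∫⁻ z, ENNReal.ofReal (Real.exp (β * ((h₁ + h₂)⁻¹ * ∫ s in (0 : ℝ)..(h₁ + h₂), F (Φ.flow s z)))) ∂P ≤
      (∫⁻ z, ENNReal.ofReal (Real.exp (β * (h₁⁻¹ * ∫ s in (0 : ℝ)..h₁, F (Φ.flow s z)))) ∂P) ^ (h₁ / (h₁ + h₂)) *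
      (∫⁻ z, ENNReal.ofReal (Real.exp (β * (h₂⁻¹ * ∫ s in (0 : ℝ)..h₂, F (Φ.flow s z)))) ∂P) ^
        (h₂ / (h₁ + h₂)) := by
  have hh : 0 < h₁ + h₂ := add_pos h₁0 h₂0
  set p : ℝ := h₁ / (h₁ + h₂) with hp
  set q : ℝ := h₂ / (h₁ + h₂) with hq
  have hp0 : 0 ≤ p := div_nonneg h₁0.le hh.le
  have hq0 : 0 ≤ q := div_nonneg h₂0.le hh.le
  have hpq : p + q = 1 := by rw [hp, hq, ← add_div, div_self hh.ne']
  set Y₁ : Config N d X → ℝ := fun z => β * (h₁⁻¹ * ∫ s in (0 : ℝ)..h₁, F (Φ.flow s z)) with hY₁def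
  set Y₂ : Config N d X → ℝ := fun z => β * (h₂⁻¹ * ∫ s in (0 : ℝ)..h₂, F (Φ.flow s z)) with hY₂def
  have hY₁m : AEMeasurable Y₁ P := (hY₁.const_mul _).const_mul β
  have hY₂m : AEMeasurable Y₂ P := (hY₂.const_mul _).const_mul β
  have hf : AEMeasurable (fun z => ENNReal.ofReal (Real.exp (Y₁ z))) P :=
    ENNReal.measurable_ofReal.comp_aemeasurable (Real.measurable_exp.comp_aemeasurable hY₁m)
  have hg : AEMeasurable (fun z => ENNReal.ofReal (Real.exp (Y₂ (Φ.flow h₁ z)))) P :=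
    (ENNReal.measurable_ofReal.comp_aemeasurable
      (Real.measurable_exp.comp_aemeasurable hY₂m)).comp_quasiMeasurePreserving hinv.quasiMeasurePreserving
  have hae : ∀ᵐ z ∂P, z ∈ Φ.good := mem_ae_iff.mpr hP
  calc ∫⁻ z, ENNReal.ofReal (Real.exp (β * ((h₁ + h₂)⁻¹ * ∫ s in (0 : ℝ)..(h₁ + h₂), F (Φ.flow s z)))) ∂P
      = ∫⁻ z, ENNReal.ofReal (Real.exp (Y₁ z)) ^ p * ENNReal.ofReal (Real.exp (Y₂ (Φ.flow h₁ z))) ^ q ∂P := by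
        refine lintegral_congr_ae ?_
        filter_upwards [hae] with z hz
        rw [window_add_eq Φ F hz (hint z hz) h₁ h₂, ← ofReal_exp_mul_left p _ hp0, ← ofReal_exp_mul_left q _ hq0,
          ← ENNReal.ofReal_mul (Real.exp_pos _).le, ← Real.exp_add]
        congr 2
        simp only [hY₁def, hY₂def, hp, hq]
        field_simp
    _ ≤ (∫⁻ z, ENNReal.ofReal (Real.exp (Y₁ z)) ∂P) ^ p *
          (∫⁻ z, ENNReal.ofReal (Real.exp (Y₂ (Φ.flow h₁ z))) ∂P) ^ q :=
        ENNReal.lintegral_mul_norm_pow_le hf hg hp0 hq0 hpq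
    _ = (∫⁻ z, ENNReal.ofReal (Real.exp (Y₁ z)) ∂P) ^ p * (∫⁻ z, ENNReal.ofReal (Real.exp (Y₂ z)) ∂P) ^ q := by
        rw [lintegral_ofReal_exp_comp_of_aemeasurable hinv hY₂m]

/-- **Two-window subadditivity with joint measurability** (the hypotheses of `TwoWindowExpMomentSubadditivity`).
[folklore] -/
theorem lintegral_exp_window_add_le (hP : P Φ.goodᶜ = 0) (hinv : ∀ t : ℝ, MeasurePreserving (Φ.flow t) P P)
    (F : Config N d X → ℝ) (hF : Measurable fun p : ℝ × Config N d X => F (Φ.flow p.1 p.2))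
    (hint : ∀ z ∈ Φ.good, ∀ a b : ℝ, IntervalIntegrable (fun s => F (Φ.flow s z)) volume a b)
    (β : ℝ) {h₁ h₂ : ℝ} (h₁0 : 0 < h₁) (h₂0 : 0 < h₂) :
    ∫⁻ z, ENNReal.ofReal (Real.exp (β * ((h₁ + h₂)⁻¹ * ∫ s in (0 : ℝ)..(h₁ + h₂), F (Φ.flow s z)))) ∂P ≤
      (∫⁻ z, ENNReal.ofReal (Real.exp (β * (h₁⁻¹ * ∫ s in (0 : ℝ)..h₁, F (Φ.flow s z)))) ∂P) ^ (h₁ / (h₁ + h₂)) *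
      (∫⁻ z, ENNReal.ofReal (Real.exp (β * (h₂⁻¹ * ∫ s in (0 : ℝ)..h₂, F (Φ.flow s z)))) ∂P) ^
        (h₂ / (h₁ + h₂)) :=
  lintegral_exp_window_add_le_of_aemeasurable Φ P hP h₁0 h₂0 (hinv h₁) F hint
    (aemeasurable_window_of_modification Φ P hP F hF (fun _ _ _ => rfl) 0 h₁)
    (aemeasurable_window_of_modification Φ P hP F hF (fun _ _ _ => rfl) 0 h₂) β

end Flow

/-- **Layer 2, proved**: the window exponential-moment subadditivity `stub_windowExpMomentSubadditivity`
(`lintegral_exp_smul_window_mul_le` at `β = 1`). [folklore] -/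
theorem stub_windowExpMomentSubadditivity : WindowExpMomentSubadditivity := by
  intro d _ X _ _ G ε N Φ P hP hinv F hF hint h _ m hm
  simpa only [one_mul] using lintegral_exp_smul_window_mul_le Φ P hP hinv F hF hint h m hm 1

/-- **Two-window layer, proved**: `stub_twoWindowExpMomentSubadditivity`. [folklore] -/
theorem stub_twoWindowExpMomentSubadditivity : TwoWindowExpMomentSubadditivity := by
  intro d _ X _ _ G ε N Φ P hP hinv F hF hint β h₁ h₂ h₁0 h₂0
  exact lintegral_exp_window_add_le Φ P hP hinv F hF hint β h₁0 h₂0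

end Summit.AtomisticToContinuum.HydrodynamicLimit.Theorems.KineticWindowGronwallWindowSubadditivity

end
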